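import Mathlib
import HarnessLib
import Literature.Analysis.FunctionSpaces.SobolevDomain
import Summits.AnomalousDissipation.AnomalousDissipation.Theorems.PointSinkConeDesingularisationStubRadialFluxShellInvariance
import Summits.AnomalousDissipation.AnomalousDissipation.Theorems.PointSinkConeDesingularisationStubEnvelopeOfFarField

/-!
# Stub `stub_dssFluxRigidity` — crux `PointSink.ConeDesingularisation` (stmt-AnomalousDissipation-19034), line `Sketch`

**DSS FLUX RIGIDITY** (the line's first lemma D1, cards `abc-window-selection` /
`flux-rigidity-note`). Let `(V, P)` be a `(-2/3, -4/3)`-discretely-self-similar weak cone on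
`ℝ³ ∖ {0}` with factor `λ > 1` (`V (λx) = λ^{-2/3} V x`, `P (λx) = λ^{-4/3} P x`), `V ∈ L²_loc`,
`P ∈ L¹_loc` off the origin, whose Bernoulli head `H = ½|V|² + P` is RENORMALISED: for every `C¹`
function `β` with bounded derivative and `β(0) = 0` the field `β(H) V` is weakly divergence-free off
the origin. Then the radial energy-flux log-mean vanishes: `∫_{1<|x|<λ} H ⟪V,x⟫/|x|² = 0`.
This generalises R. Shvydkoy, *Homogeneous solutions to the 3D Euler system*, Trans. AMS 370 (2018)
(arXiv:1510.03378), Lemma 6.1 (`C¹` homogeneous profiles are fluxless) to renormalised DSS weak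
profiles; contrapositively, every `PointFluxCone` witness has a non-renormalised head.

**Proof.** Fix a `C¹` truncation `β₁` (identity on `[-1,1]`, `|β₁(t)| ≤ min(|t|, 2)`, bounded
derivative; `β₁(t) = t χ(t)` for a bump `χ`, `dssRigidity_exists_truncation`) and put
`β_b(t) = b β₁(t/b)`, `I(b) = ∫_{1<|x|<λ} β_b(H) ⟪V,x⟫/|x|²`. The field `W_b = β_b(H) V` is locally
integrable off the origin (`|β_b| ≤ 2b`, `‖V‖ ≤ 1 + ‖V‖²`, `dssRigidity_locallyIntegrableOn`) and
weakly divergence-free (renormalisation), so the landed part 1 `stub_radialFluxShellInvariance`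
gives `I(b) = ∫_{λ<|x|<λ²} β_b(H) ⟪V,x⟫/|x|²`, which the DSS change of variables `x = λy`
(`dssRigidity_pullback`: `H(λy) = λ^{-4/3} H(y)`, flux density scales by `λ^{-5/3}`, Jacobian
`λ³`) identifies with `I(b λ^{4/3})`. Hence `k ↦ I(r^{±k})`, `r = λ^{4/3}`, are constant, while by
dominated convergence (bound `|H ⟪V,x⟫|/|x|²`, integrable by hypothesis) `I(r^k) → ∫ H ⟪V,x⟫/|x|²`
(`β_b(t) = t` once `b ≥ |t|`) and `I(r^{-k}) → 0` (`|β_b| ≤ 2b`) (`dssRigidity_core`).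
[folklore + the D1 note]
-/

noncomputable section

-- `Summit.<Summit>.<Problem>`: single-conjunct summit, the duplicate namespace is mandated (CONVENTIONS §2).
set_option linter.dupNamespace false

namespace Summit.AnomalousDissipation.AnomalousDissipation.Theorems

open MeasureTheory Filter Topology Set
open scoped Pointwise
open Literature.Analysis.FunctionSpaces

/-- Points / vector values of `ℝ³`. -/
local notation "E³" => EuclideanSpace ℝ (Fin 3)

/-! ### Truncations -/

/-- **Truncation profile.** A `C¹` function `β₁ : ℝ → ℝ` with bounded derivative, equal to the
identity on `[-1, 1]`, dominated by `|t|` and by `2`: `β₁(t) = t χ(t)` for a smooth bump `χ` equal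
to `1` on `[-1, 1]` and vanishing off `(-2, 2)`. -/
theorem dssRigidity_exists_truncation :
    ∃ β₁ : ℝ → ℝ, ContDiff ℝ 1 β₁ ∧ (∃ C : ℝ, ∀ t, ‖deriv β₁ t‖ ≤ C) ∧
      (∀ t, |t| ≤ 1 → β₁ t = t) ∧ (∀ t, |β₁ t| ≤ |t|) ∧ ∀ t, |β₁ t| ≤ 2 := by
  obtain ⟨χ, hχ1, hχ2⟩ : ∃ χ : ContDiffBump (0 : ℝ), χ.rIn = 1 ∧ χ.rOut = 2 :=
    ⟨⟨1, 2, one_pos, one_lt_two⟩, rfl, rfl⟩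
  have hs : ContDiff ℝ 1 fun t => t * χ t := contDiff_id.mul χ.contDiff
  have hle : ∀ t, |t * χ t| ≤ |t| := fun t => by
    rw [abs_mul, abs_of_nonneg χ.nonneg]
    exact mul_le_of_le_one_right (abs_nonneg t) χ.le_one
  refine ⟨fun t => t * χ t, hs, ?_, fun t ht => ?_, hle, fun t => ?_⟩
  · have hc : HasCompactSupport ((fun t : ℝ => t) * (χ : ℝ → ℝ)) := χ.hasCompactSupport.mul_left
    exact hs.continuous_deriv_one.bounded_above_of_compact_support hc.deriv
  · show t * χ t = t
    rw [χ.one_of_mem_closedBall (by rwa [hχ1, mem_closedBall_zero_iff, Real.norm_eq_abs]), mul_one]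
  · show |t * χ t| ≤ 2
    rcases le_or_gt |t| 2 with h | h
    · exact (hle t).trans h
    · rw [χ.zero_of_le_dist (by rw [hχ2, dist_zero_right, Real.norm_eq_abs]; exact h.le),
        mul_zero, abs_zero]
      exact zero_le_two

/-- Rescaled truncations `β_b(t) = b β₁(t/b)` (`b > 0`) are `C¹` with the derivative bound of
`β₁` (`β_b'(t) = β₁'(t/b)`). -/
theorem dssRigidity_scaled {β₁ : ℝ → ℝ} {C b : ℝ} (hβ : ContDiff ℝ 1 β₁)
    (hC : ∀ t, ‖deriv β₁ t‖ ≤ C) (hb : 0 < b) :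
    ContDiff ℝ 1 (fun t => b * β₁ (t / b)) ∧ ∀ t, ‖deriv (fun t => b * β₁ (t / b)) t‖ ≤ C := by
  refine ⟨contDiff_const.mul (hβ.comp (contDiff_id.div_const b)), fun t => ?_⟩
  have h : HasDerivAt (fun t => b * β₁ (t / b)) (b * (deriv β₁ (t / b) * (1 / b))) t :=
    (((hβ.differentiable one_ne_zero _).hasDerivAt).comp t ((hasDerivAt_id t).div_const b)).const_mul b
  rw [h.deriv, show b * (deriv β₁ (t / b) * (1 / b)) = deriv β₁ (t / b) by field_simp]
  exact hC _

/-! ### The truncated fields `β(H) V` -/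

/-- `x ↦ φ(H x) • V x` is locally integrable off the origin for `φ` continuous with `|φ| ≤ M`,
`H` a.e.-strongly measurable, and `V` a.e.-strongly measurable with `‖V‖²` locally integrable off
the origin: `‖φ(H) V‖ ≤ M ‖V‖ ≤ M (1 + ‖V‖²)`. -/
theorem dssRigidity_locallyIntegrableOn {V : E³ → E³} {H : E³ → ℝ} {φ : ℝ → ℝ} {M : ℝ}
    (hVm : AEStronglyMeasurable V volume) (hHm : AEStronglyMeasurable H volume)
    (hV : LocallyIntegrableOn (fun x => ‖V x‖ ^ 2) {x : E³ | x ≠ 0} volume)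
    (hφ : Continuous φ) (hM : ∀ t, |φ t| ≤ M) :
    LocallyIntegrableOn (fun x => φ (H x) • V x) {x : E³ | x ≠ 0} volume := by
  have hM0 : 0 ≤ M := (abs_nonneg _).trans (hM 0)
  refine ((locallyIntegrableOn_const M).add (hV.smul M)).mono
    ((hφ.comp_aestronglyMeasurable hHm).smul hVm) (ae_of_all _ fun x => ?_)
  simp only [Pi.add_apply, Pi.smul_apply, smul_eq_mul, norm_smul, Real.norm_eq_abs]
  rw [abs_of_nonneg (by positivity : (0 : ℝ) ≤ M + M * ‖V x‖ ^ 2)]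
  calc |φ (H x)| * ‖V x‖ ≤ M * ‖V x‖ := mul_le_mul_of_nonneg_right (hM _) (norm_nonneg _)
    _ ≤ M + M * ‖V x‖ ^ 2 := by
        nlinarith [mul_nonneg hM0 (sq_nonneg (‖V x‖ - 1)), mul_nonneg hM0 (norm_nonneg (V x))]

/-- **DSS pull-back of a shell integral.** For a `(-2/3, -4/3)`-DSS pair `(V, P)` with factor
`λ > 0`, head `H = ½|V|² + P` and any `φ : ℝ → ℝ`,
`∫_{λ<|x|<λ²} φ(H) ⟪V,x⟫/|x|² = λ^{4/3} ∫_{1<|x|<λ} φ(λ^{-4/3} H) ⟪V,x⟫/|x|²`: change variables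
`x = λ • y` (`H(λy) = λ^{-4/3} H(y)`, `⟪V(λy),λy⟫/|λy|² = λ^{-5/3} ⟪V(y),y⟫/|y|²`, Jacobian `λ³`). -/
theorem dssRigidity_pullback {lam : ℝ} {V : E³ → E³} {P : E³ → ℝ} (hlam : 0 < lam)
    (hV : ∀ x : E³, x ≠ 0 → V (lam • x) = lam ^ (-(2 / 3 : ℝ)) • V x)
    (hP : ∀ x : E³, x ≠ 0 → P (lam • x) = lam ^ (-(4 / 3 : ℝ)) * P x) (φ : ℝ → ℝ) :
    ∫ x in {x : E³ | lam < ‖x‖ ∧ ‖x‖ < lam * lam},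
        φ (‖V x‖ ^ 2 / 2 + P x) * (inner ℝ (V x) x / ‖x‖ ^ 2) =
      lam ^ (4 / 3 : ℝ) * ∫ x in {x : E³ | 1 < ‖x‖ ∧ ‖x‖ < lam},
        φ ((lam ^ (4 / 3 : ℝ))⁻¹ * (‖V x‖ ^ 2 / 2 + P x)) * (inner ℝ (V x) x / ‖x‖ ^ 2) := by
  have h43 : lam ^ (-(4 / 3 : ℝ)) = (lam ^ (4 / 3 : ℝ))⁻¹ := Real.rpow_neg hlam.le _
  have h23 : (lam ^ (-(2 / 3 : ℝ))) ^ 2 = (lam ^ (4 / 3 : ℝ))⁻¹ := by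
    rw [← h43, ← Real.rpow_natCast, ← Real.rpow_mul hlam.le]
    norm_num
  have hJ : lam ^ 3 * (lam ^ (-(2 / 3 : ℝ)) * lam⁻¹) = lam ^ (4 / 3 : ℝ) := by
    rw [show lam ^ 3 * (lam ^ (-(2 / 3 : ℝ)) * lam⁻¹) = lam ^ 2 * lam ^ (-(2 / 3 : ℝ)) by
      field_simp, ← Real.rpow_natCast, ← Real.rpow_add hlam]
    norm_num
  have h1 := Measure.setIntegral_comp_smul_of_pos volume
    (fun x => φ (‖V x‖ ^ 2 / 2 + P x) * (inner ℝ (V x) x / ‖x‖ ^ 2))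
    {x : E³ | 1 < ‖x‖ ∧ ‖x‖ < lam} hlam
  rw [coneEnvelope_smul_shell lam hlam, finrank_euclideanSpace_fin, smul_eq_mul] at h1
  have h2 : ∫ x in {x : E³ | 1 < ‖x‖ ∧ ‖x‖ < lam}, φ (‖V (lam • x)‖ ^ 2 / 2 + P (lam • x)) *
        (inner ℝ (V (lam • x)) (lam • x) / ‖lam • x‖ ^ 2) =
      ∫ x in {x : E³ | 1 < ‖x‖ ∧ ‖x‖ < lam}, lam ^ (-(2 / 3 : ℝ)) * lam⁻¹ *
        (φ ((lam ^ (4 / 3 : ℝ))⁻¹ * (‖V x‖ ^ 2 / 2 + P x)) * (inner ℝ (V x) x / ‖x‖ ^ 2)) := by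
    refine setIntegral_congr_fun ((measurableSet_lt measurable_const measurable_norm).inter
      (measurableSet_lt measurable_norm measurable_const)) fun x hx => ?_
    have hx0 : x ≠ 0 := by
      rintro rfl
      norm_num at hx
    have hxn : ‖x‖ ≠ 0 := norm_ne_zero_iff.2 hx0
    have harg : ‖V (lam • x)‖ ^ 2 / 2 + P (lam • x) =
        (lam ^ (4 / 3 : ℝ))⁻¹ * (‖V x‖ ^ 2 / 2 + P x) := by
      rw [hV x hx0, hP x hx0, norm_smul, Real.norm_eq_abs, mul_pow, sq_abs, h23, h43]
      ring
    have hin : inner ℝ (V (lam • x)) (lam • x) / ‖lam • x‖ ^ 2 =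
        lam ^ (-(2 / 3 : ℝ)) * lam⁻¹ * (inner ℝ (V x) x / ‖x‖ ^ 2) := by
      rw [hV x hx0, norm_smul, real_inner_smul_left, real_inner_smul_right, Real.norm_eq_abs,
        abs_of_pos hlam]
      field_simp
    simp only [harg, hin]
    ring
  rw [h2, integral_const_mul] at h1
  calc ∫ x in {x : E³ | lam < ‖x‖ ∧ ‖x‖ < lam * lam},
        φ (‖V x‖ ^ 2 / 2 + P x) * (inner ℝ (V x) x / ‖x‖ ^ 2)
      = lam ^ 3 * ((lam ^ 3)⁻¹ * ∫ x in {x : E³ | lam < ‖x‖ ∧ ‖x‖ < lam * lam},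
          φ (‖V x‖ ^ 2 / 2 + P x) * (inner ℝ (V x) x / ‖x‖ ^ 2)) := by
        rw [← mul_assoc, mul_inv_cancel₀ (pow_ne_zero 3 hlam.ne'), one_mul]
    _ = _ := by rw [← h1, ← mul_assoc, hJ]

/-! ### Two dominated limits -/

/-- **Two dominated limits.** If the truncated integrals `I(b) = ∫_S b β₁(H/b) g` satisfy
`I(b) = I(b r)` for all `b > 0` and some `r > 1`, where `β₁` is continuous, the identity on
`[-1, 1]`, `|β₁(t)| ≤ min(|t|, 2)`, and `H g` is integrable on `S`, then `∫_S H g = 0`: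
`I(r^k) → ∫_S H g` and `I(r^{-k}) → 0` by dominated convergence (bound `|H g|`), while both
sequences are constant. -/
theorem dssRigidity_core {S : Set E³} {H g : E³ → ℝ} {β₁ : ℝ → ℝ} {r : ℝ} (hr : 1 < r)
    (hβc : Continuous β₁) (hβid : ∀ t, |t| ≤ 1 → β₁ t = t) (hβle : ∀ t, |β₁ t| ≤ |t|)
    (hβ2 : ∀ t, |β₁ t| ≤ 2) (hHm : AEStronglyMeasurable H (volume.restrict S))
    (hgm : AEStronglyMeasurable g (volume.restrict S))
    (hint : IntegrableOn (fun x => H x * g x) S volume)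
    (key : ∀ b : ℝ, 0 < b →
      ∫ x in S, b * β₁ (H x / b) * g x = ∫ x in S, b * r * β₁ (H x / (b * r)) * g x) :
    ∫ x in S, H x * g x = 0 := by
  have hr0 : 0 < r := one_pos.trans hr
  -- measurability and domination of the truncated integrands
  have hFm : ∀ b : ℝ, AEStronglyMeasurable (fun x => b * β₁ (H x / b) * g x) (volume.restrict S) :=
    fun b => ((continuous_const.mul (hβc.comp (continuous_id.div_const b))).comp_aestronglyMeasurable
      hHm).mul hgm
  have hFle : ∀ b : ℝ, 0 < b → ∀ x : E³, ‖(b * β₁ (H x / b) * g x : ℝ)‖ ≤ ‖(H x * g x : ℝ)‖ :=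
      fun b hb x => by
    have h : b * |β₁ (H x / b)| ≤ |H x| :=
      calc b * |β₁ (H x / b)| ≤ b * |H x / b| := mul_le_mul_of_nonneg_left (hβle _) hb.le
        _ = |H x| := by rw [abs_div, abs_of_pos hb, mul_div_cancel₀ _ hb.ne']
    simp only [norm_mul, Real.norm_eq_abs, abs_of_pos hb]
    exact mul_le_mul_of_nonneg_right h (abs_nonneg _)
  -- both sequences `I(r^k)`, `I(r^{-k})` are constant
  have hup : ∀ k : ℕ, ∫ x in S, r ^ k * β₁ (H x / r ^ k) * g x =
      ∫ x in S, 1 * β₁ (H x / 1) * g x := by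
    intro k
    induction k with
    | zero => simp
    | succ k ih => rw [← ih, pow_succ, ← key _ (pow_pos hr0 k)]
  have hdown : ∀ k : ℕ, ∫ x in S, (r ^ k)⁻¹ * β₁ (H x / (r ^ k)⁻¹) * g x =
      ∫ x in S, 1 * β₁ (H x / 1) * g x := by
    intro k
    induction k with
    | zero => simp
    | succ k ih =>
      rw [← ih, key _ (inv_pos.2 (pow_pos hr0 _)), show (r ^ (k + 1))⁻¹ * r = (r ^ k)⁻¹ by
        rw [pow_succ, mul_inv, inv_mul_cancel_right₀ hr0.ne']]
  -- `b = r^k → ∞`: the truncation disappears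
  have hlim1 : Tendsto (fun k : ℕ => ∫ x in S, r ^ k * β₁ (H x / r ^ k) * g x) atTop
      (𝓝 (∫ x in S, H x * g x)) := by
    refine tendsto_integral_of_dominated_convergence (fun x => ‖H x * g x‖) (fun k => hFm _)
      hint.norm (fun k => ae_of_all _ fun x => hFle _ (pow_pos hr0 k) x)
      (ae_of_all _ fun x => tendsto_const_nhds.congr' ?_)
    filter_upwards [(tendsto_pow_atTop_atTop_of_one_lt hr).eventually_ge_atTop |H x|] with k hk
    have hk0 : 0 < r ^ k := pow_pos hr0 k
    rw [hβid _ (by rw [abs_div, abs_of_pos hk0, div_le_one hk0]; exact hk),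
      mul_div_cancel₀ _ hk0.ne']
  -- `b = r^{-k} → 0`: the truncated integrand is `O(b)`
  have hlim2 : Tendsto (fun k : ℕ => ∫ x in S, (r ^ k)⁻¹ * β₁ (H x / (r ^ k)⁻¹) * g x) atTop
      (𝓝 (∫ _ in S, (0 : ℝ))) := by
    refine tendsto_integral_of_dominated_convergence (fun x => ‖H x * g x‖) (fun k => hFm _)
      hint.norm (fun k => ae_of_all _ fun x => hFle _ (inv_pos.2 (pow_pos hr0 k)) x)
      (ae_of_all _ fun x => ?_)
    have h0 : Tendsto (fun k : ℕ => 2 * (r ^ k)⁻¹ * |g x|) atTop (𝓝 0) := by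
      have h := tendsto_inv_atTop_zero.comp (tendsto_pow_atTop_atTop_of_one_lt hr)
      simpa using (h.const_mul 2).mul_const |g x|
    refine squeeze_zero_norm (fun k => ?_) h0
    have hk0 : 0 < (r ^ k)⁻¹ := inv_pos.2 (pow_pos hr0 k)
    rw [norm_mul, norm_mul, Real.norm_eq_abs, Real.norm_eq_abs, Real.norm_eq_abs, abs_of_pos hk0]
    calc (r ^ k)⁻¹ * |β₁ (H x / (r ^ k)⁻¹)| * |g x| ≤ (r ^ k)⁻¹ * 2 * |g x| := by
          gcongr
          exact hβ2 _
      _ = 2 * (r ^ k)⁻¹ * |g x| := by ring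
  rw [integral_zero] at hlim2
  simp only [hup] at hlim1
  simp only [hdown] at hlim2
  exact (tendsto_nhds_unique tendsto_const_nhds hlim1).symm.trans
    (tendsto_nhds_unique tendsto_const_nhds hlim2)

/-! ### The stub -/

/-- **Stub `stub_dssFluxRigidity`** (DSS flux rigidity, lemma D1 of line `Sketch`). A
`(-2/3, -4/3)`-discretely-self-similar weak cone `(V, P)` on `ℝ³ ∖ {0}` (`V ∈ L²_loc`,
`P ∈ L¹_loc` off the origin) whose Bernoulli head `H = ½|V|² + P` is renormalised (`β(H) V` is
weakly divergence-free off the origin for every `C¹` `β` with bounded derivative and `β(0) = 0`) has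
zero radial energy flux: `∫_{1<|x|<λ} H ⟪V,x⟫/|x|² = 0`. Proof: the truncated fluxes
`I(b) = ∫ β_b(H) ⟪V,x⟫/|x|²`, `β_b(t) = b β₁(t/b)`, are shell invariant
(`stub_radialFluxShellInvariance` applied to `β_b(H) V`), hence `I(b) = I(b λ^{4/3})` by the DSS
change of variables (`dssRigidity_pullback`); two dominated limits (`dssRigidity_core`) give
`flux = I(1) = 0`. Generalises Shvydkoy, Trans. AMS 370 (2018), Lemma 6.1. -/
theorem stub_dssFluxRigidity :
    ∀ (lam : ℝ) (V : EuclideanSpace ℝ (Fin 3) → EuclideanSpace ℝ (Fin 3)) (P : EuclideanSpace ℝ (Fin 3) → ℝ), 1 < lam → MeasureTheory.AEStronglyMeasurable V MeasureTheory.volume → (∀ x : EuclideanSpace ℝ (Fin 3), x ≠ 0 → V (lam • x) = lam ^ (-(2 / 3 : ℝ)) • V x) → (∀ x : EuclideanSpace ℝ (Fin 3), x ≠ 0 → P (lam • x) = lam ^ (-(4 / 3 : ℝ)) * P x) → MeasureTheory.LocallyIntegrableOn (fun x => ‖V x‖ ^ 2) {x : EuclideanSpace ℝ (Fin 3) | x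 ≠ 0} MeasureTheory.volume → MeasureTheory.LocallyIntegrableOn P {x : EuclideanSpace ℝ (Fin 3) | x ≠ 0} MeasureTheory.volume → (∀ β : ℝ → ℝ, ContDiff ℝ 1 β → (∃ Cβ : ℝ, ∀ t : ℝ, ‖deriv β t‖ ≤ Cβ) → β 0 = 0 → ∀ θ : EuclideanSpace ℝ (Fin 3) → ℝ, Literature.Analysis.FunctionSpaces.IsTestFunctionOn ⟨{x : EuclideanSpace ℝ (Fin 3) | x ≠ 0}, isOpen_ne⟩ θ → ∫ x, β (‖V x‖ ^ 2 / 2 + P x) * inner ℝ (V x) (gradient θ x) = 0) → MeasureTheory.IntegrableOn (fun x => (‖V x‖ ^ 2 / 2 + P x) * (inner ℝ (V x) x / ‖x‖ ^ 2)) {x : EuclideanSpace ℝ (Fin 3) | 1 < ‖x‖ ∧ ‖x‖ < lam} MeasureTheory.volume → ∫ x in {x : EuclideanSpace ℝ (Fin 3) | 1 < ‖x‖ ∧ ‖x‖ < lam}, (‖V x‖ ^ 2 / 2 + P x) * (inner ℝ (V x) x / ‖x‖ ^ 2) = 0 := by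
  intro lam V P hlam hVm hVss hPss hVloc hPloc hren hflux
  have hlam0 : 0 < lam := one_pos.trans hlam
  obtain ⟨β₁, hβs, ⟨C₁, hC₁⟩, hβid, hβle, hβ2⟩ := dssRigidity_exists_truncation
  have hβ0 : β₁ 0 = 0 := abs_nonpos_iff.1 (by simpa using hβle 0)
  have hSm : MeasurableSet {x : E³ | 1 < ‖x‖ ∧ ‖x‖ < lam} :=
    (measurableSet_lt measurable_const measurable_norm).inter
      (measurableSet_lt measurable_norm measurable_const)
  -- measurability of the head and of the flux density
  have hPm : AEStronglyMeasurable P volume := by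
    have h := hPloc.aestronglyMeasurable
    rwa [show {x : E³ | x ≠ 0} = {0}ᶜ from rfl, restrict_compl_singleton] at h
  have hHm : AEStronglyMeasurable (fun x => ‖V x‖ ^ 2 / 2 + P x) volume :=
    (((hVm.norm.aemeasurable.pow_const 2).div_const 2).add hPm.aemeasurable).aestronglyMeasurable
  have hgm : AEStronglyMeasurable (fun x : E³ => inner ℝ (V x) x / ‖x‖ ^ 2) volume :=
    ((hVm.aemeasurable.inner aemeasurable_id).div
      (continuous_norm.pow 2).measurable.aemeasurable).aestronglyMeasurable
  refine dssRigidity_core (S := {x : E³ | 1 < ‖x‖ ∧ ‖x‖ < lam})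
    (H := fun x => ‖V x‖ ^ 2 / 2 + P x) (g := fun x : E³ => inner ℝ (V x) x / ‖x‖ ^ 2)
    (Real.one_lt_rpow hlam (by norm_num : (0 : ℝ) < 4 / 3)) hβs.continuous hβid hβle hβ2
    hHm.restrict hgm.restrict hflux fun b hb => ?_
  beta_reduce
  -- the truncated field `W_b = β_b(H) V` is locally integrable and weakly divergence-free off `0`
  obtain ⟨hcd, hCd⟩ := dssRigidity_scaled hβs hC₁ hb
  have hWloc : LocallyIntegrableOn (fun x => (b * β₁ ((‖V x‖ ^ 2 / 2 + P x) / b)) • V x)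
      {x : E³ | x ≠ 0} volume :=
    dssRigidity_locallyIntegrableOn (φ := fun t => b * β₁ (t / b)) (M := 2 * b) hVm hHm hVloc
      (continuous_const.mul (hβs.continuous.comp (continuous_id.div_const b))) fun t => by
        rw [abs_mul, abs_of_pos hb]
        nlinarith [hβ2 (t / b)]
  have hWdiv : ∀ θ : E³ → ℝ, IsTestFunctionOn ⟨{x : E³ | x ≠ 0}, isOpen_ne⟩ θ →
      ∫ x, inner ℝ ((b * β₁ ((‖V x‖ ^ 2 / 2 + P x) / b)) • V x) (gradient θ x) = 0 := by
    intro θ hθ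
    simp_rw [real_inner_smul_left]
    exact hren (fun t => b * β₁ (t / b)) hcd ⟨C₁, hCd⟩ (by simp [hβ0]) θ hθ
  -- shell invariance (part 1) and the DSS pull-back
  have h1 := stub_radialFluxShellInvariance _ 1 lam lam one_pos hlam hlam0 hWloc hWdiv
  simp_rw [mul_one, real_inner_smul_left, mul_div_assoc] at h1
  have h2 := dssRigidity_pullback hlam0 hVss hPss (fun t => b * β₁ (t / b))
  beta_reduce at h2
  rw [h1, h2, ← integral_const_mul]
  refine setIntegral_congr_fun hSm fun x _ => ?_
  rw [show (lam ^ (4 / 3 : ℝ))⁻¹ * (‖V x‖ ^ 2 / 2 + P x) / b =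
    (‖V x‖ ^ 2 / 2 + P x) / (b * lam ^ (4 / 3 : ℝ)) by ring]
  ring

end Summit.AnomalousDissipation.AnomalousDissipation.Theorems

end
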